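import Summits.AnomalousDissipation.AnomalousDissipation.Theorems.SawtoothPulseCascadeK1LocalisedCascadeSlotPairingTools

/-!
# K1loc, line `Spectral` / SeqCone — helper: THE SYMBOL-ENERGY PAIRING ON A SHEAR SLOT (fixed time)

Third S3b helper file of the prover lane on the crux `K1LocalisedCascade` (stmt-AnomalousDissipation-19491), route
`SawtoothPulseCascade` (architecture note `K1loc-architecture-findings-k1locp1.md`, F-b).  For the Lagrangian
pull-back `G = θ ∘ Φ` (`Φ = x ↦ x + cφ(x_j)eᵢ = shearMap i j (amp φ (−c))`) of a smooth scalar on `𝕋²`, a smooth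
cut-off `Ξ(x) = X(x_j)` to strips on which the slope `φ'` is `ε₁`-close to `σ`, `F = Ξ·G`, a finite set `S` of modes
and weights `0 ≤ w ≤ 1`, the time derivative of the symbol-weighted energy `∑_{k∈S} w |𝓕F|²` along the slot is
`2κ` times the PAIRING `Re ∑_{k∈S} w(k) conj(𝓕F(k)) 𝓕(Ξ·(Δθ)∘Φ)(k)` (companion `…SlotPullback`:
`∂ₜG = κ(Δθ)∘Φ`).  Main result `re_sum_pairing_le`:

  `Re ∑_{k∈S} w conj(𝓕F) 𝓕(Ξ·(Δθ)∘Φ) ≤ √(∑_{k∈S} w|𝓕F|²)·(C₂‖G‖ + 2C₁‖D̄G‖) + 2|c|ε₁‖∂ᵢF‖‖D̄_σF‖ + c²ε₁²‖∂ᵢF‖²`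

(`L²(𝕋²)` norms; `|X'| ≤ C₁`, `|X''| ≤ C₂`; `D̄ = ∂ⱼ − cφ'(x_j)∂ᵢ` the slot derivative, `D̄_σ = ∂ⱼ − cσ∂ᵢ`).
Proof = F-b of the note made rigorous: the pairing is `∫ hΞ·(Δθ)∘Φ` with the real trigonometric polynomial
`h = Re ∑_{k∈S} w 𝓕F e_k` (`…SlotParseval`); the pulled-back Green identity (`…SlotPullback`) and the product rules /
skewness of `D̄` give `−∫(∂ᵢh∂ᵢF + D̄hD̄F) − 2∫hΞ'D̄G − ∫hΞ''G`; the constant-coefficient part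
`∫(∂ᵢh∂ᵢF + D̄_σhD̄_σF) ≥ 0` is the dissipative pairing of `…SlotParseval`; the slope residual `φ' − σ` only meets
`F`-factors, which vanish off the strips.  All error terms are FIRST ORDER in `F`, `G`, uniformly in the frequency
weights — this is what makes the slot lemma κ- and frequency-uniform.
WHAT THIS IS NOT: no statement about the cascade or the stub itself; no definitions.
[cite: BedrossianCotiZelati2017, §2 (advection–diffusion by a shear in shear coordinates; k-by-k energy estimates)]
[cite: Grafakos2014, Prop. 3.2.7 (3) (Parseval on `T^d`)] [problem: turb]
-/

-- `Summit.<Summit>.<Problem>`: single-conjunct summit, the duplicate namespace segment is deliberate.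
set_option linter.dupNamespace false

noncomputable section

namespace Summit.AnomalousDissipation.AnomalousDissipation.Theorems.SawtoothPulseCascade.K1Slot

open MeasureTheory Set Filter Topology UnitAddTorus Function
open scoped ContDiff InnerProductSpace
open Literature.Analysis Literature.Analysis.FunctionSpaces Literature.Analysis.FunctionSpaces.Torus
open Literature.Analysis.FluidPDE.ShearStage

-- BODY

section Pairing

open scoped ComplexConjugate

variable {i j : Fin 2}

/-! ## §4 The pairing inequality -/

/-- **THE SYMBOL-ENERGY PAIRING ON A SHEAR SLOT (fixed time).**  Setting on `𝕋²`, `i ≠ j`: profiles `φ = P`,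
`Q = φ'`, a cut-off profile `X` with `Xd = X'`, `|X'| ≤ C₁`, `|X''| ≤ C₂`, flat-strip hypothesis
`X(y) ≠ 0 ∨ X'(y) ≠ 0 → |φ'(y) − σ| ≤ ε₁`; `Φ = shearMap i j (amp φ (−c))` (`x ↦ x + cφ(x_j)eᵢ`), `G = θ ∘ Φ`,
`F = X(x_j)·G`; a finite set of modes `S` and weights `0 ≤ w ≤ 1`.  Then
`Re ∑_{k∈S} w conj(𝓕F) 𝓕(X(x_j)·(Δθ)∘Φ) ≤ √(∑_{k∈S} w|𝓕F|²)·(C₂‖G‖ + 2C₁‖D̄G‖) + 2|c|ε₁‖∂ᵢF‖‖D̄_σF‖ + c²ε₁²‖∂ᵢF‖²`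
with `D̄ = ∂ⱼ − cQ(x_j)∂ᵢ`, `D̄_σ = ∂ⱼ − cσ∂ᵢ` and `L²` norms written as `√∫(·)²`.
[cite: BedrossianCotiZelati2017, §2 (energy method in shear coordinates)] -/
theorem re_sum_pairing_le (hij : i ≠ j) (P Q X Xd : ShearProfile) (hQ : ∀ y, Q y = deriv P y)
    (hXd : ∀ y, Xd y = deriv X y) {c σ ε₁ C₁ C₂ : ℝ} (hε₁ : 0 ≤ ε₁)
    (hC₁ : ∀ y, |Xd y| ≤ C₁) (hC₂ : ∀ y, |deriv Xd y| ≤ C₂)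
    (hflat : ∀ y, X y ≠ 0 ∨ Xd y ≠ 0 → |Q y - σ| ≤ ε₁)
    {θ G F : UnitAddTorus (Fin 2) → ℝ} (hθ : IsSmooth θ) (hG : G = θ ∘ shearMap i j (amp P (-c)))
    (hF : F = fun x => X.onCircle (x j) * G x)
    (S : Finset (Fin 2 → ℤ)) {w : (Fin 2 → ℤ) → ℝ} (hw0 : ∀ k, 0 ≤ w k) (hw1 : ∀ k, w k ≤ 1) :
    (∑ k ∈ S, (w k : ℂ) * conj (mFourierCoeff (fun y => (F y : ℂ)) k) *
        mFourierCoeff (fun y => ((X.onCircle (y j) * laplacian θ (shearMap i j (amp P (-c)) y) : ℝ) : ℂ)) k).re ≤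
      Real.sqrt (∑ k ∈ S, w k * ‖mFourierCoeff (fun y => (F y : ℂ)) k‖ ^ 2) *
          (C₂ * Real.sqrt (∫ x, G x ^ 2) +
            2 * C₁ * Real.sqrt (∫ x, (partialDeriv j G x - c * Q.onCircle (x j) * partialDeriv i G x) ^ 2)) +
        2 * |c| * ε₁ * Real.sqrt (∫ x, partialDeriv i F x ^ 2) *
          Real.sqrt (∫ x, (partialDeriv j F x - c * σ * partialDeriv i F x) ^ 2) +
        c ^ 2 * ε₁ ^ 2 * ∫ x, partialDeriv i F x ^ 2 := by
  classical
  -- smoothness of the cast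
  have hΞ : IsSmooth (fun x : UnitAddTorus (Fin 2) => X.onCircle (x j)) := isSmooth_onCircle_comp' X j
  have hΞd : IsSmooth (fun x : UnitAddTorus (Fin 2) => Xd.onCircle (x j)) := isSmooth_onCircle_comp' Xd j
  have hQs : IsSmooth (fun x : UnitAddTorus (Fin 2) => Q.onCircle (x j)) := isSmooth_onCircle_comp' Q j
  have hGs : IsSmooth G := by rw [hG]; exact hθ.comp_shearMap i j _
  have hFs : IsSmooth F := by rw [hF]; exact hΞ.mul hGs
  -- the real trigonometric polynomial `h`
  set h : UnitAddTorus (Fin 2) → ℝ :=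
    fun x => (∑ k ∈ S, ((w k : ℂ) * mFourierCoeff (fun y => (F y : ℂ)) k) * mFourier k x).re with hh_def
  have hhs : IsSmooth h := isSmooth_re_trigPoly S _
  -- derivative shorthands (as facts, not definitions)
  have hΞ' : ∀ x, partialDeriv j (fun x : UnitAddTorus (Fin 2) => X.onCircle (x j)) x = Xd.onCircle (x j) :=
    partialDeriv_onCircle_comp_eq X Xd hXd
  have hΞ'' : ∀ x, |partialDeriv j (fun x : UnitAddTorus (Fin 2) => Xd.onCircle (x j)) x| ≤ C₂ := fun x => by
    obtain ⟨y, rfl⟩ := proj_surjective x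
    rw [partialDeriv_onCircle_comp, if_pos rfl]
    exact hC₂ _
  have hΞ'b : ∀ x : UnitAddTorus (Fin 2), |Xd.onCircle (x j)| ≤ C₁ := fun x => by
    obtain ⟨y, rfl⟩ := proj_surjective x
    rw [proj_apply, ShearProfile.onCircle_coe]
    exact hC₁ _
  have hslope : ∀ x, partialDeriv j (fun x : UnitAddTorus (Fin 2) => P.onCircle (x j)) x = Q.onCircle (x j) :=
    partialDeriv_onCircle_comp_eq P Q hQ
  -- product rules for `F = Ξ G` and `a = Ξ h`
  have hdF_i : ∀ x, partialDeriv i F x = X.onCircle (x j) * partialDeriv i G x := fun x => by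
    rw [hF]; exact partialDeriv_i_onCircle_mul hij X hGs x
  have hdF_j : ∀ x, partialDeriv j F x = X.onCircle (x j) * partialDeriv j G x + Xd.onCircle (x j) * G x := fun x => by
    rw [hF, partialDeriv_j_onCircle_mul X hGs x, hΞ' x]
  have hda_i : ∀ x, partialDeriv i (fun x : UnitAddTorus (Fin 2) => X.onCircle (x j) * h x) x =
      X.onCircle (x j) * partialDeriv i h x := fun x => partialDeriv_i_onCircle_mul hij X hhs x
  have hda_j : ∀ x, partialDeriv j (fun x : UnitAddTorus (Fin 2) => X.onCircle (x j) * h x) x =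
      X.onCircle (x j) * partialDeriv j h x + Xd.onCircle (x j) * h x := fun x => by
    rw [partialDeriv_j_onCircle_mul X hhs x, hΞ' x]
  have hdΞdG_i : ∀ x, partialDeriv i (fun x : UnitAddTorus (Fin 2) => Xd.onCircle (x j) * G x) x =
      Xd.onCircle (x j) * partialDeriv i G x := fun x => partialDeriv_i_onCircle_mul hij Xd hGs x
  have hdΞdG_j : ∀ x, partialDeriv j (fun x : UnitAddTorus (Fin 2) => Xd.onCircle (x j) * G x) x =
      Xd.onCircle (x j) * partialDeriv j G x +
        partialDeriv j (fun x : UnitAddTorus (Fin 2) => Xd.onCircle (x j)) x * G x := fun x =>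
    partialDeriv_j_onCircle_mul Xd hGs x
  -- Step 1: the pairing is `∫ h · (Ξ · (Δθ)∘Φ) = ∫ (Ξ h) · (Δθ)∘Φ`
  have hg : Continuous (fun y : UnitAddTorus (Fin 2) => X.onCircle (y j) * laplacian θ (shearMap i j (amp P (-c)) y)) :=
    hΞ.continuous.mul (hθ.laplacian.continuous.comp (continuous_shearMap i j _))
  rw [re_sum_mul_conj_mul_mFourierCoeff_eq_integral S w F hg]
  have step2 : ∫ x, h x * (X.onCircle (x j) * laplacian θ (shearMap i j (amp P (-c)) x)) =
      ∫ x, (X.onCircle (x j) * h x) * laplacian θ (shearMap i j (amp P (-c)) x) :=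
    integral_congr_ae (Eventually.of_forall fun x => by ring)
  change ∫ x, h x * (X.onCircle (x j) * laplacian θ (shearMap i j (amp P (-c)) x)) ≤ _
  have hΞh : IsSmooth (fun x : UnitAddTorus (Fin 2) => X.onCircle (x j) * h x) := hΞ.mul hhs
  rw [step2, integral_mul_laplacian_comp_shear hij P c hΞh hθ, ← hG]
  -- Step 2: the integrand, pointwise
  have hpt : ∀ x, partialDeriv i (fun x : UnitAddTorus (Fin 2) => X.onCircle (x j) * h x) x * partialDeriv i G x +
      (partialDeriv j (fun x : UnitAddTorus (Fin 2) => X.onCircle (x j) * h x) x -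
          c * partialDeriv j (fun x : UnitAddTorus (Fin 2) => P.onCircle (x j)) x *
            partialDeriv i (fun x : UnitAddTorus (Fin 2) => X.onCircle (x j) * h x) x) *
        (partialDeriv j G x - c * partialDeriv j (fun x : UnitAddTorus (Fin 2) => P.onCircle (x j)) x *
          partialDeriv i G x) =
      (partialDeriv i h x * partialDeriv i F x +
        (partialDeriv j h x - c * Q.onCircle (x j) * partialDeriv i h x) *
          (partialDeriv j F x - c * Q.onCircle (x j) * partialDeriv i F x)) -
      (partialDeriv j h x - c * Q.onCircle (x j) * partialDeriv i h x) * (Xd.onCircle (x j) * G x) +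
      h x * (Xd.onCircle (x j) * (partialDeriv j G x - c * Q.onCircle (x j) * partialDeriv i G x)) := by
    intro x
    rw [hda_i, hda_j, hslope, hdF_i, hdF_j]
    ring
  simp_rw [hpt]
  -- integrability of the three pieces
  have hDh : IsSmooth (fun x : UnitAddTorus (Fin 2) => partialDeriv j h x - c * Q.onCircle (x j) * partialDeriv i h x) :=
    isSmooth_slotDeriv Q c hhs
  have hDF : IsSmooth (fun x : UnitAddTorus (Fin 2) => partialDeriv j F x - c * Q.onCircle (x j) * partialDeriv i F x) :=
    isSmooth_slotDeriv Q c hFs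
  have hDG : IsSmooth (fun x : UnitAddTorus (Fin 2) => partialDeriv j G x - c * Q.onCircle (x j) * partialDeriv i G x) :=
    isSmooth_slotDeriv Q c hGs
  have hΞdG : IsSmooth (fun x : UnitAddTorus (Fin 2) => Xd.onCircle (x j) * G x) := hΞd.mul hGs
  have hP1 : IsSmooth (fun x => partialDeriv i h x * partialDeriv i F x +
      (partialDeriv j h x - c * Q.onCircle (x j) * partialDeriv i h x) *
        (partialDeriv j F x - c * Q.onCircle (x j) * partialDeriv i F x)) :=
    ((hhs.partialDeriv i).mul (hFs.partialDeriv i)).add (hDh.mul hDF)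
  have hP2 : IsSmooth (fun x => (partialDeriv j h x - c * Q.onCircle (x j) * partialDeriv i h x) *
      (Xd.onCircle (x j) * G x)) := hDh.mul hΞdG
  have hP3 : IsSmooth (fun x => h x * (Xd.onCircle (x j) *
      (partialDeriv j G x - c * Q.onCircle (x j) * partialDeriv i G x))) := hhs.mul (hΞd.mul hDG)
  have hcsF : IsSmooth (fun x : UnitAddTorus (Fin 2) => c * σ * partialDeriv i F x) :=
    (isSmooth_const (d := Fin 2) (c * σ)).mul (hFs.partialDeriv i)
  have hDσF : IsSmooth (fun x : UnitAddTorus (Fin 2) => partialDeriv j F x - c * σ * partialDeriv i F x) :=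
    (hFs.partialDeriv j).sub hcsF
  have hcsh : IsSmooth (fun x : UnitAddTorus (Fin 2) => c * σ * partialDeriv i h x) :=
    (isSmooth_const (d := Fin 2) (c * σ)).mul (hhs.partialDeriv i)
  have hDσh : IsSmooth (fun x : UnitAddTorus (Fin 2) => partialDeriv j h x - c * σ * partialDeriv i h x) :=
    (hhs.partialDeriv j).sub hcsh
  have hΞdDG : IsSmooth (fun x : UnitAddTorus (Fin 2) => Xd.onCircle (x j) *
      (partialDeriv j G x - c * Q.onCircle (x j) * partialDeriv i G x)) := hΞd.mul hDG
  have hΞddG : IsSmooth (fun x : UnitAddTorus (Fin 2) =>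
      partialDeriv j (fun x : UnitAddTorus (Fin 2) => Xd.onCircle (x j)) x * G x) := (hΞd.partialDeriv j).mul hGs
  have iAB : Integrable (fun x => (partialDeriv i h x * partialDeriv i F x +
        (partialDeriv j h x - c * Q.onCircle (x j) * partialDeriv i h x) *
          (partialDeriv j F x - c * Q.onCircle (x j) * partialDeriv i F x)) -
      (partialDeriv j h x - c * Q.onCircle (x j) * partialDeriv i h x) * (Xd.onCircle (x j) * G x)) volume := hP1.integrable.sub hP2.integrable
  rw [integral_add iAB hP3.integrable, integral_sub hP1.integrable hP2.integrable]
  -- Step 3: skewness moves `D̄` off `h`:  `∫ D̄h · (Ξ' G) = -∫ h · D̄(Ξ' G) = -∫ h (Ξ' D̄G + Ξ'' G)`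
  have hskew := integral_slotDeriv_mul_add hij Q c hhs hΞdG
  have hDprod : ∀ x, partialDeriv j (fun x : UnitAddTorus (Fin 2) => Xd.onCircle (x j) * G x) x -
      c * Q.onCircle (x j) * partialDeriv i (fun x : UnitAddTorus (Fin 2) => Xd.onCircle (x j) * G x) x =
      Xd.onCircle (x j) * (partialDeriv j G x - c * Q.onCircle (x j) * partialDeriv i G x) +
        partialDeriv j (fun x : UnitAddTorus (Fin 2) => Xd.onCircle (x j)) x * G x := fun x => by
    rw [hdΞdG_i, hdΞdG_j]; ring
  simp_rw [hDprod] at hskew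
  have hP4 : IsSmooth (fun x => h x * (partialDeriv j (fun x : UnitAddTorus (Fin 2) => Xd.onCircle (x j)) x * G x)) :=
    hhs.mul ((hΞd.partialDeriv j).mul hGs)
  have hsplit4 : ∫ x, h x * (Xd.onCircle (x j) * (partialDeriv j G x - c * Q.onCircle (x j) * partialDeriv i G x) +
      partialDeriv j (fun x : UnitAddTorus (Fin 2) => Xd.onCircle (x j)) x * G x) =
      (∫ x, h x * (Xd.onCircle (x j) * (partialDeriv j G x - c * Q.onCircle (x j) * partialDeriv i G x))) +
        ∫ x, h x * (partialDeriv j (fun x : UnitAddTorus (Fin 2) => Xd.onCircle (x j)) x * G x) := by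
    rw [← integral_add hP3.integrable hP4.integrable]
    exact integral_congr_ae (Eventually.of_forall fun x => by ring)
  rw [hsplit4] at hskew
  -- Step 4: split `D̄ = D̄_σ - c e ∂ᵢ`, `e = Q(x_j) - σ`, inside the main term
  have hP5 : IsSmooth (fun x => partialDeriv i h x * partialDeriv i F x +
      (partialDeriv j h x - c * σ * partialDeriv i h x) * (partialDeriv j F x - c * σ * partialDeriv i F x)) :=
    ((hhs.partialDeriv i).mul (hFs.partialDeriv i)).add (hDσh.mul hDσF)
  have hQσ : IsSmooth (fun x : UnitAddTorus (Fin 2) => Q.onCircle (x j) - σ) := hQs.sub (isSmooth_const _)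
  have he1 : IsSmooth (fun x : UnitAddTorus (Fin 2) => (Q.onCircle (x j) - σ) *
      (partialDeriv j F x - c * σ * partialDeriv i F x)) := hQσ.mul hDσF
  have he2 : IsSmooth (fun x : UnitAddTorus (Fin 2) => (Q.onCircle (x j) - σ) * partialDeriv i F x) :=
    hQσ.mul (hFs.partialDeriv i)
  have he3 : IsSmooth (fun x : UnitAddTorus (Fin 2) => (Q.onCircle (x j) - σ) *
      ((Q.onCircle (x j) - σ) * partialDeriv i F x)) := hQσ.mul he2
  have hI1s : IsSmooth (fun x => partialDeriv i h x * ((Q.onCircle (x j) - σ) *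
      (partialDeriv j F x - c * σ * partialDeriv i F x))) := (hhs.partialDeriv i).mul he1
  have hI2s : IsSmooth (fun x => (partialDeriv j h x - c * σ * partialDeriv i h x) *
      ((Q.onCircle (x j) - σ) * partialDeriv i F x)) := hDσh.mul he2
  have hI3s : IsSmooth (fun x => partialDeriv i h x * ((Q.onCircle (x j) - σ) *
      ((Q.onCircle (x j) - σ) * partialDeriv i F x))) := (hhs.partialDeriv i).mul he3
  have hmain : ∫ x, (partialDeriv i h x * partialDeriv i F x +
      (partialDeriv j h x - c * Q.onCircle (x j) * partialDeriv i h x) *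
        (partialDeriv j F x - c * Q.onCircle (x j) * partialDeriv i F x)) =
      (∫ x, (partialDeriv i h x * partialDeriv i F x +
      (partialDeriv j h x - c * σ * partialDeriv i h x) * (partialDeriv j F x - c * σ * partialDeriv i F x))) -
      c * (∫ x, (partialDeriv i h x * ((Q.onCircle (x j) - σ) * (partialDeriv j F x - c * σ * partialDeriv i F x)))) -
      c * (∫ x, ((partialDeriv j h x - c * σ * partialDeriv i h x) * ((Q.onCircle (x j) - σ) * partialDeriv i F x))) +
      c ^ 2 * (∫ x, (partialDeriv i h x * ((Q.onCircle (x j) - σ) * ((Q.onCircle (x j) - σ) * partialDeriv i F x)))) := by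
    have e : ∀ x, (partialDeriv i h x * partialDeriv i F x +
        (partialDeriv j h x - c * Q.onCircle (x j) * partialDeriv i h x) *
          (partialDeriv j F x - c * Q.onCircle (x j) * partialDeriv i F x)) =
        (partialDeriv i h x * partialDeriv i F x +
      (partialDeriv j h x - c * σ * partialDeriv i h x) * (partialDeriv j F x - c * σ * partialDeriv i F x)) - c * (partialDeriv i h x * ((Q.onCircle (x j) - σ) * (partialDeriv j F x - c * σ * partialDeriv i F x))) - c * ((partialDeriv j h x - c * σ * partialDeriv i h x) * ((Q.onCircle (x j) - σ) * partialDeriv i F x)) + c ^ 2 * (partialDeriv i h x * ((Q.onCircle (x j) - σ) * ((Q.onCircle (x j) - σ) * partialDeriv i F x))) := fun x => by ring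
    rw [integral_congr_ae (Eventually.of_forall e)]
    have i1 : Integrable (fun x => (partialDeriv i h x * partialDeriv i F x +
      (partialDeriv j h x - c * σ * partialDeriv i h x) * (partialDeriv j F x - c * σ * partialDeriv i F x))) volume := hP5.integrable
    have i2 : Integrable (fun x => c * (partialDeriv i h x * ((Q.onCircle (x j) - σ) * (partialDeriv j F x - c * σ * partialDeriv i F x)))) volume := hI1s.integrable.const_mul c
    have i3 : Integrable (fun x => c * ((partialDeriv j h x - c * σ * partialDeriv i h x) * ((Q.onCircle (x j) - σ) * partialDeriv i F x))) volume := hI2s.integrable.const_mul c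
    have i4 : Integrable (fun x => c ^ 2 * (partialDeriv i h x * ((Q.onCircle (x j) - σ) * ((Q.onCircle (x j) - σ) * partialDeriv i F x)))) volume := hI3s.integrable.const_mul _
    have i12 : Integrable (fun x => (partialDeriv i h x * partialDeriv i F x +
      (partialDeriv j h x - c * σ * partialDeriv i h x) * (partialDeriv j F x - c * σ * partialDeriv i F x)) - c * (partialDeriv i h x * ((Q.onCircle (x j) - σ) * (partialDeriv j F x - c * σ * partialDeriv i F x)))) volume := i1.sub i2
    have i123 : Integrable (fun x => (partialDeriv i h x * partialDeriv i F x +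
      (partialDeriv j h x - c * σ * partialDeriv i h x) * (partialDeriv j F x - c * σ * partialDeriv i F x)) - c * (partialDeriv i h x * ((Q.onCircle (x j) - σ) * (partialDeriv j F x - c * σ * partialDeriv i F x))) - c * ((partialDeriv j h x - c * σ * partialDeriv i h x) * ((Q.onCircle (x j) - σ) * partialDeriv i F x))) volume := i12.sub i3
    rw [integral_add i123 i4, integral_sub i12 i3, integral_sub i1 i2, integral_const_mul, integral_const_mul,
      integral_const_mul]
  rw [hmain]
  -- Step 5: the dissipative term is nonnegative
  have hpos : 0 ≤ ∫ x, (partialDeriv i h x * partialDeriv i F x +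
      (partialDeriv j h x - c * σ * partialDeriv i h x) * (partialDeriv j F x - c * σ * partialDeriv i F x)) := by
    have e1 := integral_dirDeriv_re_trigPoly_mul_dirDeriv (Pi.single i (1 : ℝ)) S w hFs
    have e2 := integral_dirDeriv_re_trigPoly_mul_dirDeriv
      (fun l => (Pi.single j (1 : ℝ) : Fin 2 → ℝ) l - (c * σ) * (Pi.single i (1 : ℝ) : Fin 2 → ℝ) l) S w hFs
    simp only [sum_single_mul, sum_single_sub_mul] at e1 e2
    rw [← hh_def] at e1 e2
    have hi1 : IsSmooth (fun x => partialDeriv i h x * partialDeriv i F x) := (hhs.partialDeriv i).mul (hFs.partialDeriv i)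
    have hi2 : IsSmooth (fun x => (partialDeriv j h x - c * σ * partialDeriv i h x) *
        (partialDeriv j F x - c * σ * partialDeriv i F x)) := hDσh.mul hDσF
    rw [integral_add hi1.integrable hi2.integrable, e1, e2]
    refine add_nonneg (Finset.sum_nonneg fun k _ => ?_) (Finset.sum_nonneg fun k _ => ?_) <;>
      exact mul_nonneg (by positivity) (mul_nonneg (hw0 k) (sq_nonneg _))
  -- Step 6: pointwise slope-residual control (the residual only meets `F`-factors)
  have hres1 : ∀ x, |(Q.onCircle (x j) - σ) * (partialDeriv j F x - c * σ * partialDeriv i F x)| ≤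
      ε₁ * |partialDeriv j F x - c * σ * partialDeriv i F x| := by
    intro x
    obtain ⟨y, rfl⟩ := proj_surjective x
    by_cases hy : X (y j) ≠ 0 ∨ Xd (y j) ≠ 0
    · rw [abs_mul]
      refine mul_le_mul_of_nonneg_right ?_ (abs_nonneg _)
      simpa [proj_apply] using hflat (y j) hy
    · push Not at hy
      have h0 : partialDeriv j F (proj y) - c * σ * partialDeriv i F (proj y) = 0 := by
        rw [hdF_j, hdF_i, proj_apply, ShearProfile.onCircle_coe, ShearProfile.onCircle_coe, hy.1, hy.2]; ring
      rw [h0]; simp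
  have hres2 : ∀ x, |(Q.onCircle (x j) - σ) * partialDeriv i F x| ≤ ε₁ * |partialDeriv i F x| := by
    intro x
    obtain ⟨y, rfl⟩ := proj_surjective x
    by_cases hy : X (y j) ≠ 0 ∨ Xd (y j) ≠ 0
    · rw [abs_mul]
      refine mul_le_mul_of_nonneg_right ?_ (abs_nonneg _)
      simpa [proj_apply] using hflat (y j) hy
    · push Not at hy
      have h0 : partialDeriv i F (proj y) = 0 := by
        rw [hdF_i, proj_apply, ShearProfile.onCircle_coe, hy.1]; ring
      rw [h0]; simp
  have hres3 : ∀ x, |(Q.onCircle (x j) - σ) * ((Q.onCircle (x j) - σ) * partialDeriv i F x)| ≤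
      ε₁ ^ 2 * |partialDeriv i F x| := by
    intro x
    obtain ⟨y, rfl⟩ := proj_surjective x
    by_cases hy : X (y j) ≠ 0 ∨ Xd (y j) ≠ 0
    · have hb : |Q.onCircle (proj y j) - σ| ≤ ε₁ := by simpa [proj_apply] using hflat (y j) hy
      rw [abs_mul, abs_mul, ← mul_assoc, sq]
      exact mul_le_mul_of_nonneg_right (mul_le_mul hb hb (abs_nonneg _) hε₁) (abs_nonneg _)
    · push Not at hy
      have h0 : partialDeriv i F (proj y) = 0 := by
        rw [hdF_i, proj_apply, ShearProfile.onCircle_coe, hy.1]; ring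
      rw [h0]; simp
  have hres4 : ∀ x, |Xd.onCircle (x j) * (partialDeriv j G x - c * Q.onCircle (x j) * partialDeriv i G x)| ≤
      C₁ * |partialDeriv j G x - c * Q.onCircle (x j) * partialDeriv i G x| := fun x => by
    rw [abs_mul]; exact mul_le_mul_of_nonneg_right (hΞ'b x) (abs_nonneg _)
  have hres5 : ∀ x, |partialDeriv j (fun x : UnitAddTorus (Fin 2) => Xd.onCircle (x j)) x * G x| ≤ C₂ * |G x| :=
    fun x => by rw [abs_mul]; exact mul_le_mul_of_nonneg_right (hΞ'' x) (abs_nonneg _)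
  -- Step 7: the individual bounds
  have hC₁0 : 0 ≤ C₁ := (abs_nonneg _).trans (hC₁ 0)
  have hC₂0 : 0 ≤ C₂ := (abs_nonneg _).trans (hC₂ 0)
  have hQ_le : Real.sqrt (∫ x, h x ^ 2) ≤ Real.sqrt (∑ k ∈ S, w k * ‖mFourierCoeff (fun y => (F y : ℂ)) k‖ ^ 2) := by
    simpa only [hh_def] using sqrt_integral_reTrig_sq_le S hw0 hw1 F
  have hdi_le := sqrt_integral_dirDeriv_reTrig_sq_le (Pi.single i (1 : ℝ)) S hw0 hw1 hFs
  have hdj_le := sqrt_integral_dirDeriv_reTrig_sq_le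
    (fun l => (Pi.single j (1 : ℝ) : Fin 2 → ℝ) l - (c * σ) * (Pi.single i (1 : ℝ) : Fin 2 → ℝ) l) S hw0 hw1 hFs
  simp only [sum_single_mul, sum_single_sub_mul] at hdi_le hdj_le
  rw [← hh_def] at hdi_le hdj_le
  set QF := Real.sqrt (∑ k ∈ S, w k * ‖mFourierCoeff (fun y => (F y : ℂ)) k‖ ^ 2) with hQF
  set NiF := Real.sqrt (∫ x, partialDeriv i F x ^ 2) with hNiF
  set NjF := Real.sqrt (∫ x, (partialDeriv j F x - c * σ * partialDeriv i F x) ^ 2) with hNjF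
  set NG := Real.sqrt (∫ x, G x ^ 2) with hNG
  set NDG := Real.sqrt (∫ x, (partialDeriv j G x - c * Q.onCircle (x j) * partialDeriv i G x) ^ 2) with hNDG
  have hQF0 : 0 ≤ QF := Real.sqrt_nonneg _
  have hNiF0 : 0 ≤ NiF := Real.sqrt_nonneg _
  have hNjF0 : 0 ≤ NjF := Real.sqrt_nonneg _
  -- I₁
  have hI1 : |∫ x, partialDeriv i h x * ((Q.onCircle (x j) - σ) * (partialDeriv j F x - c * σ * partialDeriv i F x))|
      ≤ NiF * (ε₁ * NjF) := by
    refine (abs_integral_mul_le (hhs.partialDeriv i) he1).trans ?_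
    exact mul_le_mul hdi_le (sqrt_integral_sq_le_of_abs_le hDσF hε₁ hres1) (Real.sqrt_nonneg _) hNiF0
  -- I₂
  have hI2 : |∫ x, (partialDeriv j h x - c * σ * partialDeriv i h x) * ((Q.onCircle (x j) - σ) * partialDeriv i F x)|
      ≤ NjF * (ε₁ * NiF) := by
    refine (abs_integral_mul_le hDσh he2).trans ?_
    exact mul_le_mul hdj_le (sqrt_integral_sq_le_of_abs_le (hFs.partialDeriv i) hε₁ hres2)
      (Real.sqrt_nonneg _) hNjF0
  -- I₃
  have hI3 : |∫ x, partialDeriv i h x * ((Q.onCircle (x j) - σ) * ((Q.onCircle (x j) - σ) * partialDeriv i F x))|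
      ≤ NiF * (ε₁ ^ 2 * NiF) := by
    refine (abs_integral_mul_le (hhs.partialDeriv i) he3).trans ?_
    exact mul_le_mul hdi_le (sqrt_integral_sq_le_of_abs_le (hFs.partialDeriv i) (sq_nonneg _) hres3)
      (Real.sqrt_nonneg _) hNiF0
  -- I₄, I₅
  have hI4 : |∫ x, h x * (Xd.onCircle (x j) * (partialDeriv j G x - c * Q.onCircle (x j) * partialDeriv i G x))|
      ≤ QF * (C₁ * NDG) := by
    refine (abs_integral_mul_le hhs hΞdDG).trans ?_
    exact mul_le_mul hQ_le (sqrt_integral_sq_le_of_abs_le hDG hC₁0 hres4) (Real.sqrt_nonneg _) hQF0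
  have hI5 : |∫ x, h x * (partialDeriv j (fun x : UnitAddTorus (Fin 2) => Xd.onCircle (x j)) x * G x)|
      ≤ QF * (C₂ * NG) := by
    refine (abs_integral_mul_le hhs hΞddG).trans ?_
    exact mul_le_mul hQ_le (sqrt_integral_sq_le_of_abs_le hGs hC₂0 hres5) (Real.sqrt_nonneg _) hQF0
  -- assemble
  have hsq : NiF * (ε₁ ^ 2 * NiF) = ε₁ ^ 2 * ∫ x, partialDeriv i F x ^ 2 := by
    rw [hNiF, mul_comm, mul_assoc, Real.mul_self_sqrt (integral_nonneg fun x => sq_nonneg _)]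
  have a1 := (abs_le.1 hI1); have a2 := (abs_le.1 hI2); have a3 := (abs_le.1 hI3)
  have a4 := (abs_le.1 hI4); have a5 := (abs_le.1 hI5)
  have hc1 : c * (∫ x, partialDeriv i h x * ((Q.onCircle (x j) - σ) * (partialDeriv j F x - c * σ * partialDeriv i F x)))
      ≤ |c| * (NiF * (ε₁ * NjF)) := by
    calc _ ≤ |c * ∫ x, partialDeriv i h x * ((Q.onCircle (x j) - σ) *
          (partialDeriv j F x - c * σ * partialDeriv i F x))| := le_abs_self _
      _ = |c| * _ := abs_mul _ _
      _ ≤ |c| * (NiF * (ε₁ * NjF)) := mul_le_mul_of_nonneg_left hI1 (abs_nonneg _)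
  have hc2 : c * (∫ x, (partialDeriv j h x - c * σ * partialDeriv i h x) * ((Q.onCircle (x j) - σ) * partialDeriv i F x))
      ≤ |c| * (NjF * (ε₁ * NiF)) := by
    calc _ ≤ |c * ∫ x, (partialDeriv j h x - c * σ * partialDeriv i h x) *
          ((Q.onCircle (x j) - σ) * partialDeriv i F x)| := le_abs_self _
      _ = |c| * _ := abs_mul _ _
      _ ≤ |c| * (NjF * (ε₁ * NiF)) := mul_le_mul_of_nonneg_left hI2 (abs_nonneg _)
  have hc3 : -(c ^ 2 * ∫ x, partialDeriv i h x * ((Q.onCircle (x j) - σ) *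
      ((Q.onCircle (x j) - σ) * partialDeriv i F x))) ≤ c ^ 2 * (ε₁ ^ 2 * ∫ x, partialDeriv i F x ^ 2) := by
    rw [← hsq, ← mul_neg]
    exact mul_le_mul_of_nonneg_left (by linarith) (sq_nonneg _)
  nlinarith [hpos, a4.1, a4.2, a5.1, a5.2, hc1, hc2, hc3, hQF0, hNiF0, hNjF0, abs_nonneg c]

end Pairing

end Summit.AnomalousDissipation.AnomalousDissipation.Theorems.SawtoothPulseCascade.K1Slot
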